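import Literature.IUT.HodgeTheaters.KitNFSideEval
import Literature.IUT.HodgeTheaters.KitCoreThetaBridge

/-!
# [IUTchI] Proposition 6.7 END-TO-END at the converse-dictionary instance: the functorial algorithm
# `Θ^±-bridge ↦ Θ-bridge` over the §4 datum BUILT FROM the kits (post-freeze additive D13, proofs only)

S. Mochizuki, *Inter-universal Teichmüller theory I*, kurims manuscript (May 2020): Proposition 6.7 p. 167
l. 22–33 ("we obtain a functorial algorithm for constructing a [well-defined, up to a unique isomorphism!]
`𝒟-Θ`-bridge `†𝔇_{T^⋇} → †𝔇_>` as in Definition 4.6, (ii)"), Definition 4.6 (ii) p. 111, Example 4.4 (i), (ii),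
(iv) pp. 105–107 ([IUTchI] Prop 6.7 p.167) [claim: Mochizuki2012, status: disputed] (D-0012 claim key, series
status DISPUTED; PROOF-ONLY companion — no definition, no new `Prop` fact; nothing of the series is asserted and no
side is taken on [IUTchIII] Cor. 3.12).  Node IUTchI:Prop6.7 (plan/L5 NODE RULE #17 law (γ) `ThetaAgrees`;
LAYER5-CERT-NODES.tsv row 1187, holder abc-iut-w4-d054).

## What is proved

abc-iut-L5-t3's converse dictionary (`KitNFSideDatum.lean`, `KitNFSideEval.lean`) builds the §4 datum
`BaseThetaDatum.ofKitCore K … N B E` FROM abc-iut-L5-t4's base kit `K`, an NF kit `N`, a mono-analytic binder `B`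
and an evaluation-section binder `E`, proves that over it the `𝒟`-dictionary `KitCore.ofKit` is the identity, and —
with `E := M.evalBinder hl5 Z hne hrig` generated by the multiplicative kit `M` and a zero-label class `Z` — proves
the law (γ) `ThetaAgrees` as a THEOREM (`thetaAgrees_ofKit`) modulo the Example 4.4 (ii) bi-saturation `hsat` of the
kit's classes `φ^Θ_{v_j}`.  This file plugs that instance into the Prop 6.7 chain of record (abc-iut-w4-d054
`PMBaseThetaBridgeProofs`, abc-iut-L5-t3 `KitCoreBridge` / `KitCoreBridgeProp67` / `KitCoreThetaBridge`,
abc-iut-w5-d228 `PMBaseProp67AlgorithmSub`) and reads the dictionary away (`e = id`, `amb = ι`,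
`ambModel = Iso.refl`), so that at the kits of record, modulo exactly the named atoms
`{N, B, Z, hne, hrig, hsat}` (no `KitCore`, no `ThetaAgrees` hypothesis):

* `thetaBridgeAlgorithm_ofKit` — **Prop 6.7 with Def 4.6 (ii) AS TYPED IN §4**: for every `𝒟-Θ^±`-bridge `B♭` of
  the kit, the output `B♭.thetaBridgeData M _` is, place by place, isomorphic to an honest §4 `𝒟-Θ`-bridge
  `B' : (ofKitCore …).DThetaBridge` of abc-iut-L5-t3's Definition 4.6 (ii), the identifications carrying the
  constituents `†φ^Θ_{j,v}` of `B'` EXACTLY onto the output's;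
* `thetaBridgeData_poly_eq_modelThetaBridge_ofKit` — with the printed labelling `T^⋇ ⥲ 𝔽_l^⋇`: the constituent at
  `q ∈ T^⋇` is exactly a conjugate of the MODEL `φ^Θ_{v_j}` of Example 4.4 (iv), `j = ofFin (starLabel q)`;
* `thetaBridgeData_isModel_ofKit` — the `isModel` clause of Def 4.6 (ii) field for field;
* `PMBaseKit.DThetaPMBridge.card_thetaBridgeData_hom_of_labelRigid` (kit level, modulo the Ex 4.4 (iv) label
  rigidity at one bad place) / `card_thetaBridgeData_hom_ofKit` (at the kits of record, the rigidity derived from the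
  atom `hrig`, the bad place from Def 3.1 (e)) — "well-defined, up to a UNIQUE isomorphism": between the outputs at
  any two `𝒟-Θ^±`-bridges there is exactly one Def-4.6 (ii) morphism (`Nat.card = 1`);
* `isModelConjugate_iff_exists_dThetaBridge_ofKit` — the kit reading and the §4 reading of Def 4.6 (ii) agree.

The parity input `hl : Odd l` is abc-iut-L5-t2's `odd_of_five_le (Fact.out) hl5` at a prime `l ≥ 5` (not restated).

Everything is by NAME; no statement of another seat is restated; every `theorem` is kernel-checked.  A law instance
(`hsat`, `hrig`) is an assumption label at the genuine multiplicative kit (no genuine `MultKit` constructor is in the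
tree), not an endorsement; typed ≠ proved elsewhere.
-/

namespace Literature.IUT.HodgeTheaters

open CategoryTheory

universe u

namespace PMBaseKit.DThetaPMBridge

variable {l : ℕ} {K : PMBaseKit.{u} l} (M : K.MultKit)

/-- **"well-defined, up to a UNIQUE isomorphism"** ([IUTchI] Prop 6.7 p. 167 l. 23; Prop 4.8 (ii) p. 115 "the set of
isomorphisms between two `𝒟-Θ`-bridges is of cardinality one"), KIT LEVEL: between the `𝒟-Θ`-bridge data produced
by the algorithm from ANY two `𝒟-Θ^±`-bridges of the kit there is EXACTLY ONE morphism of Def 4.6 (ii) data —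
existence is abc-iut-w5-d228's `thetaBridgeData_hom_nonempty` (unconditional), uniqueness their
`thetaBridgeData_hom_subsingleton_of_labelRigid` MODULO the label-rigidity law of Example 4.4 (iv) at one bad place
(`hrig`: the two-sided saturations of `φ^Θ_{v_j}` for distinct `j` differ; GAP-LEDGER G-w4d056-1).  The `KitCore`
form is abc-iut-L5-t3's `KitCore.card_thetaBridgeData_hom`; this is the dictionary-free form the layer certificate
can bind. ([IUTchI] Prop 6.7 p.167) [claim: Mochizuki2012, status: disputed] -/
theorem card_thetaBridgeData_hom_of_labelRigid (hl : Odd l) {v : K.V} (hv : v ∈ K.bad)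
    (hrig : Function.Injective fun j : Fin ((l - 1) / 2) => M.thetaPolySat j v hv (K.model v) (K.model v))
    (B₁ B₂ : K.DThetaPMBridge) :
    Nat.card (DThetaBridgeData.Hom (B₁.thetaBridgeData M hl) (B₂.thetaBridgeData M hl)) = 1 := by
  haveI := thetaBridgeData_hom_subsingleton_of_labelRigid M hl hv hrig B₁ B₂
  obtain ⟨φ⟩ := thetaBridgeData_hom_nonempty M hl B₁ B₂
  haveI : Unique (DThetaBridgeData.Hom (B₁.thetaBridgeData M hl) (B₂.thetaBridgeData M hl)) :=
    uniqueOfSubsingleton φ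
  exact Nat.card_unique

end PMBaseKit.DThetaPMBridge

namespace BaseThetaDatum

variable {l : ℕ} (K : PMBaseKit.{u} l) [Fact l.Prime] (hl5 : 5 ≤ l) (hba : ∀ x ∈ K.bad, x ∉ K.arc)
  (N : K.NFKit) (B : K.MonoBinder) (M : K.MultKit)
  (Z : ∀ x : K.V, x ∈ K.bad → Set (K.model x ⟶ K.model x))
  (hne : ∀ x (hx : x ∈ K.bad) j, (M.polyOfLabel hl5 Z x hx j).Nonempty)
  (hrig : ∀ x (hx : x ∈ K.bad) {j j' : FlAbs l} {g g' : K.model x ⟶ K.model x}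
    (θ β : K.model x ≅ K.model x), g ∈ M.polyOfLabel hl5 Z x hx j → g' ∈ M.polyOfLabel hl5 Z x hx j' →
      g' = θ.hom ≫ g ≫ β.hom → j = j')

/-- (bookkeeping) Over the datum built from the kits the dictionary transport `f ↦ ambModel⁻¹ ∘ amb(f) ∘ ambModel`
of a model endomorphism is `f` itself read in the ambient category (`amb = ι`, `ambModel = Iso.refl`).
([IUTchI] Def 6.1 p.156) [claim: Mochizuki2012, status: disputed] -/
theorem KitCore.ofKit_transport (hb : K.bad.Nonempty) (E : K.EvalBinder) (x : K.V)
    (f : (ofKitCore K hl5 hba hb N B E).D ((KitCore.ofKit K hl5 hba hb N B E).e x) ⟶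
      (ofKitCore K hl5 hba hb N B E).D ((KitCore.ofKit K hl5 hba hb N B E).e x)) :
    ((KitCore.ofKit K hl5 hba hb N B E).ambModel x).inv ≫ ((KitCore.ofKit K hl5 hba hb N B E).amb x).map f ≫
        ((KitCore.ofKit K hl5 hba hb N B E).ambModel x).hom = f.hom := by
  erw [Category.id_comp, Category.comp_id]
  rfl

/-- **[IUTchI] Proposition 6.7 at the kits of record, Definition 4.6 (ii) AS TYPED IN §4** (p. 167 l. 22–29 "a
functorial algorithm for constructing a … `𝒟-Θ`-bridge `†𝔇_{T^⋇} → †𝔇_>` as in Definition 4.6, (ii)"): over the §4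
datum `ofKitCore K … N B (M.evalBinder …)` built from the kits, for EVERY `𝒟-Θ^±`-bridge `B♭` of the base kit the
output `B♭.thetaBridgeData M _` of the algorithm is the image of an honest §4 `𝒟-Θ`-bridge `B'` of abc-iut-L5-t3's
`BaseThetaDatum.DThetaBridge` — index sets matched by `ι`, isomorphisms `κ`, `γ` of the constituent local objects,
conjugation by which carries the constituent poly-morphisms `†φ^Θ_{ι j, v}` of `B'` EXACTLY onto the output's.  The
dictionary is the identity here (`KitCore.ofKit`), so the comparison functor is the inclusion of local objects and
`f ↦ f.hom`.  Hypotheses: the named atoms of the converse dictionary and the Ex 4.4 (ii) bi-saturation `hsat` only.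
([IUTchI] Prop 6.7 p.167) [claim: Mochizuki2012, status: disputed] -/
theorem thetaBridgeAlgorithm_ofKit (hb : K.bad.Nonempty)
    (hsat : ∀ x (hx : x ∈ K.bad) (j : Fin (lStar l)) (θ β : K.model x ≅ K.model x) {g : K.model x ⟶ K.model x},
      g ∈ M.thetaPolyBad j x hx → θ.hom ≫ g ≫ β.hom ∈ M.thetaPolyBad j x hx) (hl : Odd l) :
    PMBaseKit.DThetaPMBridge.ThetaBridgeAlgorithm M
      (fun D => ∃ (B' : (ofKitCore K hl5 hba hb N B (M.evalBinder hl5 Z hne hrig)).DThetaBridge) (ι : D.J ≃ B'.J)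
          (κ : ∀ j x, (B'.capsule (ι j) x).obj ≅ (D.capsule j).obj x)
          (γ : ∀ x, (B'.cod x).obj ≅ D.codomain.obj x),
          ∀ j x, D.poly j x = {g | ∃ f ∈ B'.poly (ι j) x, g = (κ j x).inv ≫ f.hom ≫ (γ x).hom})
      hl :=
  KitCore.thetaBridgeAlgorithm_dThetaBridge (thetaAgrees_ofKit K hl5 hba hb N B M Z hne hrig hsat) hl

/-- **Prop 6.7 at the kits of record with the printed labelling `T^⋇ ⥲ 𝔽_l^⋇`** (p. 167 with Def 4.6 (ii) p. 111
"there exist isomorphisms `𝔇_> ⥲ †𝔇_>`, `𝔇_⋆ ⥲ †𝔇_{T^⋇}`, conjugation by which maps `φ^Θ_⋆ ↦ †φ^Θ_⋆`"): the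
constituent of the output at the class `q ∈ T^⋇` is EXACTLY a conjugate of the MODEL poly-morphism `φ^Θ_{v_j}` of
Example 4.4 (iv) of the datum built from the kits (`modelThetaBridge`: at bad `v` the saturated evaluation sections of
label `j` generated by `M.thetaPolyBad`, at good `v` the full poly-isomorphism), `j = ofFin (starLabel q)` along
abc-iut-L5-t4's canonical labelling. ([IUTchI] Prop 6.7 p.167) [claim: Mochizuki2012, status: disputed] -/
theorem thetaBridgeData_poly_eq_modelThetaBridge_ofKit (hb : K.bad.Nonempty)
    (hsat : ∀ x (hx : x ∈ K.bad) (j : Fin (lStar l)) (θ β : K.model x ≅ K.model x) {g : K.model x ⟶ K.model x},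
      g ∈ M.thetaPolyBad j x hx → θ.hom ≫ g ≫ β.hom ∈ M.thetaPolyBad j x hx) (hl : Odd l) (Bpm : K.DThetaPMBridge) :
    ∃ (κ : ∀ (q : Bpm.grpT.AbsStar) (x : K.V), K.model x ≅ (Bpm.starCapsule q).obj x)
      (γ : ∀ x, K.model x ≅ Bpm.codomain.obj x),
      ∀ (q : Bpm.grpT.AbsStar) x, (Bpm.thetaBridgeData M hl).poly (ULift.up q) x =
        {g | ∃ f ∈ (ofKitCore K hl5 hba hb N B (M.evalBinder hl5 Z hne hrig)).modelThetaBridge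
            (FlStar.ofFin l (Bpm.starLabel hl q)) x,
          g = (κ q x).inv ≫ f.hom ≫ (γ x).hom} := by
  obtain ⟨κ, γ, h⟩ := KitCore.thetaBridgeData_poly_eq_transport_modelThetaBridge
    (thetaAgrees_ofKit K hl5 hba hb N B M Z hne hrig hsat) hl Bpm
  refine ⟨κ, γ, fun q x => (h q x).trans ?_⟩
  ext g
  constructor
  · rintro ⟨f, hf, rfl⟩
    exact ⟨f, hf, rfl⟩
  · rintro ⟨f, hf, rfl⟩
    exact ⟨f, hf, rfl⟩

/-- **The `isModel` clause of Def 4.6 (ii) for the outputs of Prop 6.7 at the kits of record, field for field**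
(Def 4.6 (ii) p. 111): a bijection `ι : 𝔽_l^⋇ ⥲ T^⋇`, isomorphisms `κ_j : 𝒟_v ⥲ †𝒟_{ι(j),v}`, `δ : 𝒟_v ⥲ †𝒟_{>,v}`,
with `†φ^Θ_{ι(j),v}` EXACTLY `κ_j⁻¹ ∘ φ^Θ_{v_j} ∘ δ` for the MODEL `φ^Θ_{v_j} = modelThetaBridge j v` of the datum built
from the kits. ([IUTchI] Def 4.6 (ii) p.111) [claim: Mochizuki2012, status: disputed] -/
theorem thetaBridgeData_isModel_ofKit (hb : K.bad.Nonempty)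
    (hsat : ∀ x (hx : x ∈ K.bad) (j : Fin (lStar l)) (θ β : K.model x ≅ K.model x) {g : K.model x ⟶ K.model x},
      g ∈ M.thetaPolyBad j x hx → θ.hom ≫ g ≫ β.hom ∈ M.thetaPolyBad j x hx) (hl : Odd l) (Bpm : K.DThetaPMBridge) :
    ∃ (ι : FlStar l ≃ (Bpm.thetaBridgeData M hl).J)
      (κ : ∀ j, (PMBaseKit.DStrip.model K).Iso ((Bpm.thetaBridgeData M hl).capsule (ι j)))
      (δ : (PMBaseKit.DStrip.model K).Iso (Bpm.thetaBridgeData M hl).codomain),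
      ∀ (j : FlStar l) (x : K.V), (Bpm.thetaBridgeData M hl).poly (ι j) x =
        {h | ∃ f ∈ (ofKitCore K hl5 hba hb N B (M.evalBinder hl5 Z hne hrig)).modelThetaBridge j x,
          h = (κ j x).inv ≫ f.hom ≫ (δ x).hom} := by
  obtain ⟨ι, κ, δ, h⟩ := KitCore.thetaBridgeData_isModel
    (thetaAgrees_ofKit K hl5 hba hb N B M Z hne hrig hsat) hl Bpm
  refine ⟨ι, κ, δ, fun j x => (h j x).trans ?_⟩
  ext g
  constructor
  · rintro ⟨f, hf, rfl⟩
    exact ⟨f, hf, by rw [KitCore.ofKit_transport]; rfl⟩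
  · rintro ⟨f, hf, rfl⟩
    exact ⟨f, hf, by rw [KitCore.ofKit_transport]; rfl⟩

include hl5 hba N B Z hne hrig in
/-- **"well-defined, up to a UNIQUE isomorphism" at the kits of record** ([IUTchI] Prop 6.7 p. 167 l. 23): over the
datum built from the kits the label-rigidity input of `card_thetaBridgeData_hom_of_labelRigid` is DERIVED through the
(identity) dictionary from the atom `hrig` of the evaluation-section binder (abc-iut-L5-t3's
`KitCore.thetaPolyBad_labelRigid` at `thetaAgrees_ofKit`), and the bad place it needs exists by Def 3.1 (e) (`hb`, an
input of `ofKitCore`): `Nat.card = 1` modulo exactly the converse-dictionary atoms and `hsat`.  (The NF kit `N` and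
the mono-analytic binder `B` enter only because the dictionary instance is stated over the full datum.)
([IUTchI] Prop 6.7 p.167) [claim: Mochizuki2012, status: disputed] -/
theorem card_thetaBridgeData_hom_ofKit (hb : K.bad.Nonempty)
    (hsat : ∀ x (hx : x ∈ K.bad) (j : Fin (lStar l)) (θ β : K.model x ≅ K.model x) {g : K.model x ⟶ K.model x},
      g ∈ M.thetaPolyBad j x hx → θ.hom ≫ g ≫ β.hom ∈ M.thetaPolyBad j x hx) (hl : Odd l) (B₁ B₂ : K.DThetaPMBridge) :
    Nat.card (PMBaseKit.DThetaBridgeData.Hom (B₁.thetaBridgeData M hl) (B₂.thetaBridgeData M hl)) = 1 := by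
  have h := KitCore.card_thetaBridgeData_hom (thetaAgrees_ofKit K hl5 hba hb N B M Z hne hrig hsat) hl
    (Set.Nonempty.some_mem hb) B₁ B₂
  exact h

/-- **The two readings of Def 4.6 (ii) agree at the kits of record**: `𝒟-Θ`-bridge data over the kit is a conjugate
of the kit-level model (`thetaPolyBad` at bad `v`, the full poly-isomorphism at good `v`) iff it is, place by place,
the image of a §4 `𝒟-Θ`-bridge of the datum built from the kits. ([IUTchI] Def 4.6 (ii) p.111) [claim: Mochizuki2012, status: disputed] -/
theorem isModelConjugate_iff_exists_dThetaBridge_ofKit (hb : K.bad.Nonempty)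
    (hsat : ∀ x (hx : x ∈ K.bad) (j : Fin (lStar l)) (θ β : K.model x ≅ K.model x) {g : K.model x ⟶ K.model x},
      g ∈ M.thetaPolyBad j x hx → θ.hom ≫ g ≫ β.hom ∈ M.thetaPolyBad j x hx) (D : K.DThetaBridgeData) :
    (∃ (e : D.J ≃ Fin ((l - 1) / 2)) (κ : ∀ j, (PMBaseKit.DStrip.model K).Iso (D.capsule j))
        (δ : (PMBaseKit.DStrip.model K).Iso D.codomain),
        (∀ (j : D.J) (v : K.V) (hv : v ∈ K.bad), D.poly j v =
            {h | ∃ g ∈ M.thetaPolyBad (e j) v hv, h = (κ j v).inv ≫ g ≫ (δ v).hom}) ∧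
        (∀ (j : D.J) (v : K.V), v ∉ K.bad → D.poly j v =
            {h | ∃ g : K.model v ≅ K.model v, h = (κ j v).inv ≫ g.hom ≫ (δ v).hom})) ↔
    ∃ (B' : (ofKitCore K hl5 hba hb N B (M.evalBinder hl5 Z hne hrig)).DThetaBridge) (ι : D.J ≃ B'.J)
      (κ : ∀ j x, (B'.capsule (ι j) x).obj ≅ (D.capsule j).obj x)
      (γ : ∀ x, (B'.cod x).obj ≅ D.codomain.obj x),
      ∀ j x, D.poly j x = {g | ∃ f ∈ B'.poly (ι j) x, g = (κ j x).inv ≫ f.hom ≫ (γ x).hom} :=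
  KitCore.isModelConjugate_iff_exists_dThetaBridge (thetaAgrees_ofKit K hl5 hba hb N B M Z hne hrig hsat) D

end BaseThetaDatum

end Literature.IUT.HodgeTheaters
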